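import Mathlib
import Summits.ResolutionOfSingularities.ResolutionOfSingularities.Theorems.WildQuotientsWildQuotientResolutionS1W1NNStep
import Summits.ResolutionOfSingularities.ResolutionOfSingularities.Theorems.WildQuotientsWildQuotientResolutionS1W1NMilnorFloor

/-!
# S1 / W1N cascade — `stub_W1N_print_holds : ∀ p : ℕ, p.Prime → S1.W1NPrint p` (the stub statement VERBATIM, all five supports discharged)

Crux stmt-ResolutionOfSingularities-17941 (`WildQuotients.CyclicQuotientFourfolds`), S1a line `s1a-logminvertex`,
stub `stub_W1N_print`, sub-line `w1n-cascade` (idea-1 `W1N-LINE.md`; proofs from `CombinedW1NPrint.scratch.lean`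
f33256b0cfc42851).  [OURS · L1 W4.5c] — NOT a statement of the manuscript; counted 0 post-V5.

The closing file of the sub-line `w1n-cascade` (plan-1 LANDING PLAN 19:45:46Z (b), last link): the statement of the stub
`stub_W1N_print` of BOTH S1a lines, proved by `W1NCascade.W1NPrint_of_cascade` (p558932) from
`W1NMilnorFloor.milnorFloor_holds` (p560140), `W1NCascade.isolatedSucc_holds` (W-8 `…S1W1NNTwoExit`),
`W1NCascade.oStep_holds` (W-8), `W1NCascade.nStep_holds` (W-11 `…S1W1NNStep`), `W1NCascade.nTwoExit_holds` (W-8).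
The lead closes the registered stub by `exact Summit.….Theorems.WildQuotientResolution.stub_W1N_print_holds`.
-/

-- single-problem summit: the doubled namespace component `ResolutionOfSingularities` is forced
set_option linter.dupNamespace false

noncomputable section

namespace Summit.ResolutionOfSingularities.ResolutionOfSingularities.Theorems.WildQuotientResolution

/-- **`S1.W1NPrint p` for every prime `p` — the statement of the stub `stub_W1N_print` VERBATIM** (S1a lines
`s1a-logminvertex` / `s1a-tamebr`; the primality hypothesis is not used): `W1NCascade.W1NPrint_of_cascade` applied to
the five discharged supports `W1NMilnorFloor.milnorFloor_holds` (p560140), `W1NCascade.isolatedSucc_holds`,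
`W1NCascade.oStep_holds`, `W1NCascade.nStep_holds`, `W1NCascade.nTwoExit_holds`. [OURS · L1 W4.5c] — NOT a statement
of the manuscript; counted 0 post-V5. -/
theorem stub_W1N_print_holds : ∀ p : ℕ, p.Prime → S1.W1NPrint p := fun p _ =>
  S1.W1NCascade.W1NPrint_of_cascade S1.W1NMilnorFloor.milnorFloor_holds S1.W1NCascade.isolatedSucc_holds
    S1.W1NCascade.oStep_holds S1.W1NCascade.nStep_holds S1.W1NCascade.nTwoExit_holds p

end Summit.ResolutionOfSingularities.ResolutionOfSingularities.Theorems.WildQuotientResolution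

namespace Summit.ResolutionOfSingularities.ResolutionOfSingularities.Theorems.WildQuotientResolution.S1

/-- **Registered stub `stub_W1N_print` of line `s1a-logminvertex` (crux `CyclicQuotientFourfolds`,
stmt-ResolutionOfSingularities-17941), BY NAME and with the signature VERBATIM** (appended by lead-1 g6: the registrar
closes a stub only on a theorem NAMED as the stub inside `…Theorems.WildQuotientResolution.S1`; a separate closer file
is a pure restatement of `stub_W1N_print_holds` above and is refused by the dedup lint, so the alias lives here, next
to its content). [OURS · L1 W4.5c] — NOT a statement of the manuscript. -/
theorem stub_W1N_print : ∀ p : ℕ, p.Prime → S1.W1NPrint p :=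
  Summit.ResolutionOfSingularities.ResolutionOfSingularities.Theorems.WildQuotientResolution.stub_W1N_print_holds

end Summit.ResolutionOfSingularities.ResolutionOfSingularities.Theorems.WildQuotientResolution.S1

end
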